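import Summits.QuantumFields.YangMills.Theorems.BalabanUVNodesN19BillFlag

/-!
# BalabanUVNodes ∕ node N19 (NE7) — THE DILUTE-COUNT DATUM: the A2 inhabitant of the bill flag on the COUNT key (classes = the loud count `m ≤ n_K`, Poisson young law
# `ε_K^m∕m!` shared by the runs, run B distorted by `e^{m·σ_K}`): the flag is NECESSARY (`Σ n_K σ_K = ∞` ⇒ no unflagged summable `Core`) and SUFFICIENT (the complete binder list
# from the MEAN bill `σ_K ε_K e^{σ_K}` and a Markov dial; the square-root dial), with one explicit regime where both happen

Cell `pub-ymgap` (HUMAN RULING D-0062 Track A ∕ D-0149 width seats), WIDTH SEAT `pub-ymgap-dag-n19-w1` (node n19 = NE7, seat 1 of 3), generation g5, CLAIM-2 ∕ INTENT-2.  Route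
`Summits/QuantumFields/YangMills/Theses/BalabanUVNodes.lean`, key item K3⁷ `SpineGivenEndpointR13SepCoPH` (stmt-QuantumFields-20544; v5 stub 2 `stub_expansion13H`, conjuncts N19′
`KeyedCoreEdgeHolderD4` ∧ N20 `KeyedRelWeight`); filed `--kind proof --supports … --as helper`.  COUNT-NEUTRAL.  THEOREMS ONLY (0 `def`, 0 `sorry`).  ADDITIVE — imports this seat's g5
`…Theorems.BalabanUVNodesN19BillFlag` (CLAIM-1: `hybridNE7_billFlag_of_meanBill`, `sqrtDial_eq`; through it p602850 `not_coreEdge_of_unsummable_gap`, the tree's `Spine/NE7/Targets`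
(`Core`), `T4MatchingAssembly` (`HybridNE7`)) ONLY; modifies nothing.

WHY.  CLAIM-1 states the bill flag with every letter a HYPOTHESIS.  A2 hygiene (START-LIST §n19 (2′): non-degenerate inhabitants, NON-EMPTY flag) asks for ONE datum on which (a) the
factorisation shape, (Y) and the two MEAN-BILL letters are CHECKED, (b) the flag is genuinely NEEDED (no unflagged summable `Core`), (c) some dial PAYS.  THE DATUM (the count key
itself — by dag-n20-w1's FILE F p616042∕`…CountStatistic` the count is what a block caricature sees; no configuration ∕ Bernoulli carrier of theirs is used): at level `K` the classes
are the loud counts `m ∈ {0,…,n_K}`; run A's class weight `ε_K^m∕m!` (a DILUTE loud gas: un-normalised Poisson law, parameter `ε_K > 0`), run B's `R_K·(ε_K e^{σ_K})^m∕m!` — the SAME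
young law times an arbitrary old scalar `R_K > 0` times a per-loud-unit two-run LR factor `e^{σ_K}` (`σ_K ≥ 0`): bill `s_A = 0`, `s_B = m·σ_K`.
* §1 [folklore] `sum_natCast_mul_pow_div_factorial_le` (truncated Poisson mean: `Σ_{m≤n} m·x^m∕m! ≤ x·Σ_{m≤n} x^m∕m!`) · `sum_bill_mul_poisson_le` (mean-bill form).
* §2 [folklore] `weightB_eq` (`R·(εe^σ)^m∕m! = (R e^{mσ})·ε^m∕m!`) · `log_weightB_sub_log_weightA` (two-run log-ratio `log R + m·σ`).
* §3 [folklore] ★★ `not_coreEdge_diluteCount_unflagged` — EMPTY bad class ⇒ the classes `m = 0`, `m = n_K` are `n_K σ_K` apart ⇒ NO summable `Core` when `Σ_K n_K σ_K = ∞`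
  (p602850 `not_coreEdge_of_unsummable_gap` BY NAME): the flag is NECESSARY.
* §4 [folklore] ★★ `hybridNE7_diluteCount_billFlag` — every hypothesis of CLAIM-1's `hybridNE7_billFlag_of_meanBill` DISCHARGED on the datum with `μ_K = σ_K ε_K e^{σ_K}` (run B's
  tilted Poisson parameter times `σ_K`; run A's mean bill `σ_K ε_K ≤ μ_K`), for ANY Markov dial `S` (`μ∕S < 1` summable, `Σ S∕vol < ∞`): `HybridNE7 … {m | S_K < m σ_K} (μ∕S) 0 0 0
  (S∕vol)` · ★★ `hybridNE7_diluteCount_sqrtDial` (the square-root dial: weight = radius = `√(μ_K∕vol)`).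
* §5 [folklore] ONE REGIME, numbers: `σ_K = 1∕(K+1)`, `n_K = K`, `ε_K = (K+1)^{−3}`, `vol ≥ 3` — `not_summable_natCast_mul_one_div_succ` (`Σ n_K σ_K = ∞`: flag NEEDED) ·
  `regime_mu_lt` (`μ_K < 3∕(K+1)^4`) · ★ `regime_sqrtDial` (`√(μ_K∕vol) < 1` and summable: flag PAID) — so §3 and §4 apply simultaneously with a non-empty flag from `K ≥ 1` on.
READINGS (located; nothing proposed).  (i) The worst class's bill `n_K σ_K` may diverge while the MEAN bill is summably small after a square root: «flag by the bill, pay by the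
mean» is strictly stronger than paying the worst class, exactly in the dilute regime (rare high counts carrying an `O(1)` two-run bill).  (ii) Nothing here is Bałaban's; the datum
is a caricature of the loud-count statistic, not a reading of any density of the programme.

HONEST FRAMING.  One explicit finite datum (free sequences `n, ε, σ, R`, one numerical regime) + [folklore] finite-sum ∕ real-series arithmetic over the tree's SHAPES (`Core`,
`HybridNE7`); nothing of Bałaban's is asserted or instantiated; no estimate of the programme is proved.  NE7 ∕ NE7b NOT PRINTED as two-run statements for d = 4 ∕ NOT proved; N19 ∕
N20 NOT discharged; K3⁷ OPEN, not claimed, v5 untouched; counts UNMOVED (typed 28∕28 · discharged 5∕27, A 5∕28).  Everything below is PROVED (0 `sorry`, 0 named facts, standard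
axioms); no decl carries a cite tag.  One finite four-torus programme at fixed ε — NOT ℝ⁴, NOT infinite volume, NOT OS, NOT a mass gap, NOT the Clay problem (R4 closes the
conditional finite-𝕋⁴ rung `BalabanLadder.UV` only).
-/

noncomputable section

open Finset
open scoped BigOperators

namespace Summit.QuantumFields.YangMills.BalabanUVNodes.N19BillFlagDiluteCount

open Summit.QuantumFields.BalabanUV.T4Continuum.Spine.NE7 (Core)
open Literature.MathematicalPhysics.QuantumFieldTheory.Balaban1983to89
open T4WeightBudget (RelWeightBound)
open T4MatchingAssembly (HybridNE7)
open Summit.QuantumFields.YangMills.BalabanUVNodes.N19HybridBeyondTarget (not_coreEdge_of_unsummable_gap)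
open Summit.QuantumFields.YangMills.BalabanUVNodes.N19BillFlag (hybridNE7_billFlag_of_meanBill sqrtDial_eq)

/-! ## §1 The dilute (Poisson) count law: its mean count is at most its parameter [folklore] -/

/-- **POISSON PARTIAL SUMS** [folklore]: for `x ≥ 0` and every cut-off `n`, `Σ_{m ≤ n} m·x^m∕m! ≤ x·Σ_{m ≤ n} x^m∕m!` — the (truncated, un-normalised) Poisson count law of
parameter `x` has mean count at most `x` (shift `m·x^m∕m! = x·x^{m−1}∕(m−1)!` and drop nothing but a non-negative last term). -/
theorem sum_natCast_mul_pow_div_factorial_le {x : ℝ} (hx : 0 ≤ x) (n : ℕ) :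
    ∑ m ∈ Finset.range (n + 1), (m : ℝ) * (x ^ m / (m.factorial : ℝ)) ≤ x * ∑ m ∈ Finset.range (n + 1), x ^ m / (m.factorial : ℝ) := by
  have hterm : ∀ m : ℕ, ((m + 1 : ℕ) : ℝ) * (x ^ (m + 1) / ((m + 1).factorial : ℝ)) = x * (x ^ m / (m.factorial : ℝ)) := by
    intro m
    have hm : ((m + 1 : ℕ) : ℝ) ≠ 0 := by positivity
    have hf : (m.factorial : ℝ) ≠ 0 := by positivity
    rw [Nat.factorial_succ, Nat.cast_mul, pow_succ]
    field_simp
  calc ∑ m ∈ Finset.range (n + 1), (m : ℝ) * (x ^ m / (m.factorial : ℝ))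
      = ∑ m ∈ Finset.range n, ((m + 1 : ℕ) : ℝ) * (x ^ (m + 1) / ((m + 1).factorial : ℝ)) + ((0 : ℕ) : ℝ) * (x ^ 0 / (Nat.factorial 0 : ℝ)) :=
        Finset.sum_range_succ' _ _
    _ = x * ∑ m ∈ Finset.range n, x ^ m / (m.factorial : ℝ) := by
        rw [Nat.cast_zero, zero_mul, add_zero, Finset.mul_sum]
        exact Finset.sum_congr rfl fun m _ => hterm m
    _ ≤ x * ∑ m ∈ Finset.range (n + 1), x ^ m / (m.factorial : ℝ) := by
        refine mul_le_mul_of_nonneg_left ?_ hx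
        rw [Finset.sum_range_succ]
        exact le_add_of_nonneg_right (by positivity)

/-- The mean-BILL form: with a per-unit modulus `σ ≥ 0`, `Σ_{m ≤ n} (m·σ)·(c·x^m∕m!) ≤ (σ·x)·Σ_{m ≤ n} c·x^m∕m!` (`c ≥ 0` a common factor). [folklore] -/
theorem sum_bill_mul_poisson_le {x σ c : ℝ} (hx : 0 ≤ x) (hσ : 0 ≤ σ) (hc : 0 ≤ c) (n : ℕ) :
    ∑ m ∈ Finset.range (n + 1), ((m : ℝ) * σ) * (c * (x ^ m / (m.factorial : ℝ))) ≤
      (σ * x) * ∑ m ∈ Finset.range (n + 1), c * (x ^ m / (m.factorial : ℝ)) := by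
  have h := sum_natCast_mul_pow_div_factorial_le hx n
  have e1 : ∑ m ∈ Finset.range (n + 1), ((m : ℝ) * σ) * (c * (x ^ m / (m.factorial : ℝ))) =
      (σ * c) * ∑ m ∈ Finset.range (n + 1), (m : ℝ) * (x ^ m / (m.factorial : ℝ)) := by
    rw [Finset.mul_sum]; exact Finset.sum_congr rfl fun m _ => by ring
  have e2 : (σ * x) * ∑ m ∈ Finset.range (n + 1), c * (x ^ m / (m.factorial : ℝ)) =
      (σ * c) * (x * ∑ m ∈ Finset.range (n + 1), x ^ m / (m.factorial : ℝ)) := by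
    rw [Finset.mul_sum, Finset.mul_sum, Finset.mul_sum]; exact Finset.sum_congr rfl fun m _ => by ring
  rw [e1, e2]
  exact mul_le_mul_of_nonneg_left h (mul_nonneg hσ hc)

/-! ## §2 The dilute-count datum on the COUNT key: classes `m ≤ n_K`, run A `ε_K^m∕m!`, run B `R_K·(ε_K e^{σ_K})^m∕m!` [folklore] -/

section Datum
variable {l₀ vol : ℝ} {n : ℕ → ℕ} {ε σ R S : ℕ → ℝ}

/-- Run B's class weight is run A's times the old scalar `R_K` and the per-unit LR distortion `e^{m·σ_K}`: `R·(ε e^σ)^m∕m! = (R·e^{mσ})·(ε^m∕m!)`. [folklore] -/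
theorem weightB_eq (K m : ℕ) :
    R K * ((ε K * Real.exp (σ K)) ^ m / (m.factorial : ℝ)) = (R K * Real.exp ((m : ℝ) * σ K)) * (ε K ^ m / (m.factorial : ℝ)) := by
  rw [mul_pow, Real.exp_nat_mul]; ring

/-- The two-run log-ratio at count `m` is `log R_K + m·σ_K` (`ε_K, R_K > 0`). [folklore] -/
theorem log_weightB_sub_log_weightA {K : ℕ} (m : ℕ) (hε : 0 < ε K) (hR : 0 < R K) :
    Real.log (R K * ((ε K * Real.exp (σ K)) ^ m / (m.factorial : ℝ))) - Real.log (ε K ^ m / (m.factorial : ℝ)) =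
      Real.log (R K) + (m : ℝ) * σ K := by
  have hA : 0 < ε K ^ m / (m.factorial : ℝ) := by positivity
  rw [weightB_eq, Real.log_mul (mul_pos hR (Real.exp_pos _)).ne' hA.ne', Real.log_mul hR.ne' (Real.exp_pos _).ne', Real.log_exp]
  ring

/-! ## §3 The flag is NECESSARY: with an empty bad class no summable `Core` when `Σ_K n_K·σ_K = ∞` [folklore] -/

/-- **★★ NO FLAG, NO `Core`** [folklore].  At the count key with EMPTY bad class the classes `m = 0` and `m = n_K` have two-run log-ratios `log R_K` and `log R_K + n_K·σ_K`: a gap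
`n_K·σ_K ≥ 0` at every level, so if `Σ_K n_K·σ_K = ∞` there is NO `δ` with `Core l₀ vol (range (n+1)) ∅ A B δ ∧ Summable δ` (p602850 `not_coreEdge_of_unsummable_gap` BY NAME;
`0 ≤ l₀`, any `vol`). The worst class's bill `n_K·σ_K` is what an unflagged proof must pay. -/
theorem not_coreEdge_diluteCount_unflagged (hl₀ : 0 ≤ l₀) (hε : ∀ K, 0 < ε K) (hσ : ∀ K, 0 ≤ σ K) (hR : ∀ K, 0 < R K)
    (hdiv : ¬ Summable fun K => (n K : ℝ) * σ K) :
    ¬ ∃ δ : ℕ → ℝ, Core l₀ vol (fun K => Finset.range (n K + 1)) (fun _ _ => (∅ : Finset ℕ))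
        (fun K _ m => ε K ^ m / (m.factorial : ℝ)) (fun K _ m => R K * ((ε K * Real.exp (σ K)) ^ m / (m.factorial : ℝ))) δ ∧ Summable δ := by
  refine not_coreEdge_of_unsummable_gap (g := fun K => (n K : ℝ) * σ K) (fun K => by have := hσ K; positivity) hdiv fun K => ?_
  refine ⟨0, by simpa using hl₀, n K, by simp, 0, by simp, by have := hε K; positivity, by have := hε K; positivity, ?_⟩
  rw [log_weightB_sub_log_weightA (n K) (hε K) (hR K), log_weightB_sub_log_weightA 0 (hε K) (hR K)]
  simp

/-! ## §4 The flag is SUFFICIENT: the complete binder list with the bill flag and a Markov dial; the square-root dial [folklore] -/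

/-- **★★ THE DILUTE-COUNT DATUM INHABITS THE BILL FLAG** [folklore] (`…N19BillFlag.hybridNE7_billFlag_of_meanBill` BY NAME).  Young factors `ε^m∕m!` IDENTICAL in the two runs
(`Core … ∅ m_A m_B 0`), run A undistorted (`s_A = 0`, `R_A = 1`), run B `= R·e^{mσ}·m_B` (`s_B = m·σ`, old scalar `R` arbitrary); mean-bill letters from §1 with
`μ_K = σ_K·ε_K·e^{σ_K}` (run B's tilted parameter; run A's mean bill `σε ≤ μ`); ANY dial `S_K > 0` with `μ_K∕S_K < 1` summable and `Σ S_K∕vol < ∞` ⇒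
`HybridNE7 l₀ vol (range (n+1)) A B {m | S_K < m·σ_K} (μ∕S) 0 0 0 (S∕vol)` — flag NON-EMPTY as soon as `S_K < n_K σ_K`, and by §3 NEEDED when `Σ n_K σ_K = ∞`. -/
theorem hybridNE7_diluteCount_billFlag (hvol : 0 < vol) (hε : ∀ K, 0 < ε K) (hσ : ∀ K, 0 ≤ σ K) (hR : ∀ K, 0 < R K)
    (hS : ∀ K, 0 < S K) (hlt : ∀ K, σ K * ε K * Real.exp (σ K) / S K < 1)
    (hW : Summable fun K => σ K * ε K * Real.exp (σ K) / S K) (hrad : Summable fun K => S K / vol) :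
    HybridNE7 l₀ vol (fun K => Finset.range (n K + 1))
      (fun K _ m => ε K ^ m / (m.factorial : ℝ)) (fun K _ m => R K * ((ε K * Real.exp (σ K)) ^ m / (m.factorial : ℝ)))
      (fun K _ => (Finset.range (n K + 1)).filter fun m => S K < (m : ℝ) * σ K)
      (fun K => σ K * ε K * Real.exp (σ K) / S K) (fun _ _ _ => 0) (fun _ _ _ => 0) (fun _ => 0) (fun K => S K / vol) := by
  have hx : ∀ K, 0 ≤ ε K * Real.exp (σ K) := fun K => by have := hε K; positivity
  have h := hybridNE7_billFlag_of_meanBill (l₀ := l₀) (T := fun K => Finset.range (n K + 1))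
    (A := fun K _ m => ε K ^ m / (m.factorial : ℝ)) (B := fun K _ m => R K * ((ε K * Real.exp (σ K)) ^ m / (m.factorial : ℝ)))
    (mA := fun K _ m => ε K ^ m / (m.factorial : ℝ)) (mB := fun K _ m => ε K ^ m / (m.factorial : ℝ))
    (sA := fun _ _ _ => (0 : ℝ)) (sB := fun K _ m => (m : ℝ) * σ K) (RA := fun _ => 1) (RB := R) (r := fun _ => 0)
    (μ := fun K => σ K * ε K * Real.exp (σ K)) (S := S) hvol ?_ ?_ (fun K _ _ m _ => by have := hε K; positivity)
    (fun _ => one_pos) hR ?_ (fun K _ _ m _ => by have := hε K; positivity) (fun K _ _ m _ => by have := hR K; have := hx K; positivity)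
    (fun K _ _ m _ => by have := hσ K; positivity) ?_ ?_ hS (fun K => by have := hσ K; have := hε K; positivity) hlt hW (by simpa using hrad)
  · simpa only [zero_add] using h
  · -- run A: `e^{∓0}·(m_A·1)` sandwiches `A = m_A`
    intro K t _ m _
    simp
  · -- run B: `e^{−mσ}·(m_B·R) ≤ R·e^{mσ}·m_B = e^{mσ}·(m_B·R)`
    intro K t _ m _
    have hmσ : 0 ≤ (m : ℝ) * σ K := by have := hσ K; positivity
    have hmR : 0 ≤ ε K ^ m / (m.factorial : ℝ) * R K := by have := hε K; have := hR K; positivity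
    rw [weightB_eq]
    constructor
    · calc Real.exp (-((m : ℝ) * σ K)) * (ε K ^ m / (m.factorial : ℝ) * R K) ≤ Real.exp ((m : ℝ) * σ K) * (ε K ^ m / (m.factorial : ℝ) * R K) :=
          mul_le_mul_of_nonneg_right (Real.exp_le_exp.mpr (by linarith)) hmR
        _ = R K * Real.exp ((m : ℝ) * σ K) * (ε K ^ m / (m.factorial : ℝ)) := by ring
    · exact le_of_eq (by ring)
  · -- (Y): identical young factors, constant `0`, radius `0`
    intro K
    refine ⟨0, fun t _ m _ => ?_⟩
    simp
  · -- mean bill, run A: `Σ (0 + mσ)·ε^m∕m! ≤ σε·Σ ≤ σεe^σ·Σ`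
    intro K t _
    have h1 := sum_bill_mul_poisson_le (hε K).le (hσ K) zero_le_one (n K)
    have hsum0 : 0 ≤ ∑ m ∈ Finset.range (n K + 1), ε K ^ m / (m.factorial : ℝ) := Finset.sum_nonneg fun m _ => by have := hε K; positivity
    have hεle : σ K * ε K ≤ σ K * ε K * Real.exp (σ K) := le_mul_of_one_le_right (mul_nonneg (hσ K) (hε K).le) (Real.one_le_exp (hσ K))
    calc ∑ m ∈ Finset.range (n K + 1), (0 + (m : ℝ) * σ K) * (ε K ^ m / (m.factorial : ℝ))
        = ∑ m ∈ Finset.range (n K + 1), ((m : ℝ) * σ K) * (1 * (ε K ^ m / (m.factorial : ℝ))) := Finset.sum_congr rfl fun m _ => by ring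
      _ ≤ (σ K * ε K) * ∑ m ∈ Finset.range (n K + 1), 1 * (ε K ^ m / (m.factorial : ℝ)) := h1
      _ = (σ K * ε K) * ∑ m ∈ Finset.range (n K + 1), ε K ^ m / (m.factorial : ℝ) := by simp only [one_mul]
      _ ≤ (σ K * ε K * Real.exp (σ K)) * ∑ m ∈ Finset.range (n K + 1), ε K ^ m / (m.factorial : ℝ) := mul_le_mul_of_nonneg_right hεle hsum0
  · -- mean bill, run B: `Σ (0 + mσ)·R x^m∕m! ≤ σx·Σ R x^m∕m!`, `x = εe^σ`
    intro K t _
    have h1 := sum_bill_mul_poisson_le (hx K) (hσ K) (hR K).le (n K)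
    calc ∑ m ∈ Finset.range (n K + 1), (0 + (m : ℝ) * σ K) * (R K * ((ε K * Real.exp (σ K)) ^ m / (m.factorial : ℝ)))
        = ∑ m ∈ Finset.range (n K + 1), ((m : ℝ) * σ K) * (R K * ((ε K * Real.exp (σ K)) ^ m / (m.factorial : ℝ))) :=
          Finset.sum_congr rfl fun m _ => by rw [zero_add]
      _ ≤ (σ K * (ε K * Real.exp (σ K))) * ∑ m ∈ Finset.range (n K + 1), R K * ((ε K * Real.exp (σ K)) ^ m / (m.factorial : ℝ)) := h1
      _ = (σ K * ε K * Real.exp (σ K)) * ∑ m ∈ Finset.range (n K + 1), R K * ((ε K * Real.exp (σ K)) ^ m / (m.factorial : ℝ)) := by ring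

/-- **★★ … WITH THE SQUARE-ROOT DIAL** [folklore]: `S_K := √(μ_K·vol)` (`σ_K > 0`): weight and radius both `√(μ_K∕vol)`, `μ_K = σ_K ε_K e^{σ_K}`; so `√(μ_K∕vol) < 1` summable ⇒
`HybridNE7 … {m | √(μ_K·vol) < m·σ_K} (√(μ∕vol)) 0 0 0 (√(μ∕vol))`.  Regime where the flag is both NEEDED and PAID: `n_K σ_K ≍ 1` (so `Σ n_K σ_K = ∞`) with `Σ_K √(σ_K ε_K∕vol) < ∞`
— a dilute loud gas whose rare high counts carry an `O(1)` two-run bill. -/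
theorem hybridNE7_diluteCount_sqrtDial (hvol : 0 < vol) (hε : ∀ K, 0 < ε K) (hσ : ∀ K, 0 < σ K) (hR : ∀ K, 0 < R K)
    (hlt : ∀ K, Real.sqrt (σ K * ε K * Real.exp (σ K) / vol) < 1) (hsum : Summable fun K => Real.sqrt (σ K * ε K * Real.exp (σ K) / vol)) :
    HybridNE7 l₀ vol (fun K => Finset.range (n K + 1))
      (fun K _ m => ε K ^ m / (m.factorial : ℝ)) (fun K _ m => R K * ((ε K * Real.exp (σ K)) ^ m / (m.factorial : ℝ)))
      (fun K _ => (Finset.range (n K + 1)).filter fun m => Real.sqrt (σ K * ε K * Real.exp (σ K) * vol) < (m : ℝ) * σ K)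
      (fun K => Real.sqrt (σ K * ε K * Real.exp (σ K) / vol)) (fun _ _ _ => 0) (fun _ _ _ => 0) (fun _ => 0)
      (fun K => Real.sqrt (σ K * ε K * Real.exp (σ K) / vol)) := by
  have hμ : ∀ K, 0 < σ K * ε K * Real.exp (σ K) := fun K => by have := hσ K; have := hε K; positivity
  have e1 : (fun K => σ K * ε K * Real.exp (σ K) / Real.sqrt (σ K * ε K * Real.exp (σ K) * vol)) =
      fun K => Real.sqrt (σ K * ε K * Real.exp (σ K) / vol) := funext fun K => (sqrtDial_eq (hμ K) hvol).1
  have e2 : (fun K => Real.sqrt (σ K * ε K * Real.exp (σ K) * vol) / vol) = fun K => Real.sqrt (σ K * ε K * Real.exp (σ K) / vol) :=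
    funext fun K => (sqrtDial_eq (hμ K) hvol).2
  have h := hybridNE7_diluteCount_billFlag (l₀ := l₀) (n := n) (R := R) (S := fun K => Real.sqrt (σ K * ε K * Real.exp (σ K) * vol)) hvol hε
    (fun K => (hσ K).le) hR (fun K => Real.sqrt_pos.mpr (mul_pos (hμ K) hvol)) (fun K => by rw [(sqrtDial_eq (hμ K) hvol).1]; exact hlt K)
    (by rw [e1]; exact hsum) (by rw [e2]; exact hsum)
  rw [e1, e2] at h
  exact h

end Datum

/-! ## §5 One explicit regime where the flag is both NEEDED and PAID: `σ_K = 1∕(K+1)`, `n_K = K`, `ε_K = (K+1)^{−3}`, `vol ≥ 3` [folklore] -/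

section Regime
open Filter Topology

/-- `Σ_K n_K σ_K = Σ_K K∕(K+1) = ∞` (the terms tend to `1`): in the regime the unflagged `Core` edge fails by §3. [folklore] -/
theorem not_summable_natCast_mul_one_div_succ : ¬ Summable fun K : ℕ => (K : ℝ) * (1 / ((K : ℝ) + 1)) := by
  intro h
  have h0 := h.tendsto_atTop_zero
  have h1 : Tendsto (fun K : ℕ => (K : ℝ) * (1 / ((K : ℝ) + 1))) atTop (𝓝 1) := by
    have e : (fun K : ℕ => (K : ℝ) * (1 / ((K : ℝ) + 1))) = fun K : ℕ => 1 - 1 / ((K : ℝ) + 1) := by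
      funext K
      have hK : (K : ℝ) + 1 ≠ 0 := by positivity
      field_simp
      ring
    rw [e]
    simpa using (tendsto_const_nhds (x := (1 : ℝ))).sub tendsto_one_div_add_atTop_nhds_zero_nat
  exact one_ne_zero (tendsto_nhds_unique h1 h0)

/-- In the regime `μ_K = σ_K ε_K e^{σ_K} = e^{1∕(K+1)}∕(K+1)^4 < 3∕(K+1)^4` (`e < 3`). [folklore] -/
theorem regime_mu_lt (K : ℕ) :
    1 / ((K : ℝ) + 1) * (1 / ((K : ℝ) + 1) ^ 3) * Real.exp (1 / ((K : ℝ) + 1)) < 3 / ((K : ℝ) + 1) ^ 4 := by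
  have hK : 0 < (K : ℝ) + 1 := by positivity
  have hexp : Real.exp (1 / ((K : ℝ) + 1)) < 3 := by
    have h1 : 1 / ((K : ℝ) + 1) ≤ 1 := by rw [div_le_one hK]; linarith [show (0 : ℝ) ≤ K from Nat.cast_nonneg K]
    have h9 := Real.exp_one_lt_d9
    exact (Real.exp_le_exp.mpr h1).trans_lt (h9.trans (by norm_num))
  have e : 1 / ((K : ℝ) + 1) * (1 / ((K : ℝ) + 1) ^ 3) = 1 / ((K : ℝ) + 1) ^ 4 := by field_simp
  rw [e, div_mul_eq_mul_div, one_mul]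
  exact div_lt_div_of_pos_right hexp (by positivity)

/-- … hence for `vol ≥ 3`: `√(μ_K∕vol) < 1` (indeed `≤ 1∕(K+1)^2`) and `Σ_K √(μ_K∕vol) < ∞` — the two conditions of the square-root dial (§4). [folklore] -/
theorem regime_sqrtDial {vol : ℝ} (hvol : 3 ≤ vol) :
    (∀ K : ℕ, Real.sqrt (1 / ((K : ℝ) + 1) * (1 / ((K : ℝ) + 1) ^ 3) * Real.exp (1 / ((K : ℝ) + 1)) / vol) < 1) ∧
      Summable fun K : ℕ => Real.sqrt (1 / ((K : ℝ) + 1) * (1 / ((K : ℝ) + 1) ^ 3) * Real.exp (1 / ((K : ℝ) + 1)) / vol) := by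
  have hv : 0 < vol := by linarith
  have hsq : ∀ K : ℕ, 1 / ((K : ℝ) + 1) * (1 / ((K : ℝ) + 1) ^ 3) * Real.exp (1 / ((K : ℝ) + 1)) / vol < (1 / ((K : ℝ) + 1) ^ 2) ^ 2 := by
    intro K
    have hK : 0 < (K : ℝ) + 1 := by positivity
    calc 1 / ((K : ℝ) + 1) * (1 / ((K : ℝ) + 1) ^ 3) * Real.exp (1 / ((K : ℝ) + 1)) / vol < 3 / ((K : ℝ) + 1) ^ 4 / vol :=
          div_lt_div_of_pos_right (regime_mu_lt K) hv
      _ ≤ 3 / ((K : ℝ) + 1) ^ 4 / 3 := div_le_div_of_nonneg_left (by positivity) (by norm_num) hvol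
      _ = (1 / ((K : ℝ) + 1) ^ 2) ^ 2 := by field_simp
  have hle : ∀ K : ℕ, Real.sqrt (1 / ((K : ℝ) + 1) * (1 / ((K : ℝ) + 1) ^ 3) * Real.exp (1 / ((K : ℝ) + 1)) / vol) ≤ 1 / ((K : ℝ) + 1) ^ 2 :=
    fun K => (Real.sqrt_le_sqrt (hsq K).le).trans_eq (Real.sqrt_sq (by positivity))
  refine ⟨fun K => ?_, ?_⟩
  · have h1 : (1 / ((K : ℝ) + 1) ^ 2) ^ 2 ≤ 1 ^ 2 := by
      have hK : (1 : ℝ) ≤ ((K : ℝ) + 1) ^ 2 := one_le_pow₀ (by linarith [show (0 : ℝ) ≤ K from Nat.cast_nonneg K])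
      have : 1 / ((K : ℝ) + 1) ^ 2 ≤ 1 := by rw [div_le_one (by positivity)]; exact hK
      exact pow_le_pow_left₀ (by positivity) this 2
    exact (Real.sqrt_lt' one_pos).mpr ((hsq K).trans_le h1)
  · refine Summable.of_nonneg_of_le (fun K => Real.sqrt_nonneg _) hle ?_
    have h2 : Summable fun K : ℕ => 1 / ((K : ℝ)) ^ 2 := Real.summable_one_div_nat_pow.mpr one_lt_two
    simpa [Nat.cast_add, Nat.cast_one] using (summable_nat_add_iff 1).mpr h2

end Regime

end Summit.QuantumFields.YangMills.BalabanUVNodes.N19BillFlagDiluteCount
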